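import Mathlib
import Summits.QuantumFields.YangMills.Theorems.CovariantCurrentDoorCurrentStateOrthogonal
import Summits.QuantumFields.YangMills.Theorems.TransportFieldPolyakovLineDerivative
import HarnessLib

/-!
# Crux `CovariantCurrentDoor.CurrentNormFloor` ⟨stmt-QuantumFields-23380⟩, line `birth` (planner ym-idea-4 g17, sha16 6a6aadba): the registered stub
# `stub_robertsonB` — CLOSED, via the transport-field regularity kit

`RobertsonBP`: for the reflection-odd cross observable `G = Σ_s [(Re tr P₀P₁⁻¹)² − (Re tr P₀P₁)²]/16` and the covariant current `X` (smoothed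
colour-electric direction `b_{x+ê₀}`), `⟨(XG)Ω, Ω⟩² ≤ 4‖XΩ‖²‖GΩ‖²`.  Route: per base site `x`, the direction is continuous and blind to `(x,0)`
(`smoothedField_update_dir0`); `G` is differentiable along the flow with a continuous derivative field — the direction-`0` Polyakov line through
`s` is differentiable (kit tranche 5 `exists_hasDerivAt_lineHolonomy`) and the direction-`1` line is constant (`lineHolonomy_update_of_ne`) —
hence Lipschitz; the right-Haar identity `∫ ∂_t|₀ (GΩ²)(U_t) dU = 0` (✓ `integral_deriv_flow_eq_zero`, with `Ω` differentiable/Lipschitz by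
tranches 1–3b) gives `∫ (∂_xG)Ω² = −2∫ GΩ∂_xΩ`; summing, `⟨(XG)Ω,Ω⟩ = −2⟨GΩ, XΩ⟩` and Cauchy–Schwarz finishes.
HONEST FRAMING: the crux (its coherence-floor / reverse-Hölder stubs) is OPEN; K2a and the YM mass gap are NOT proved.  No `sorry`, no new axiom;
the `abbrev` is a registered-stub copy (verbatim), not a citable fact.  References: [cite: ReedSimonIV1978, Thm. XIII.43]; [cite: Creutz2022, Ch. 11].
-/

set_option autoImplicit false

noncomputable section

open MeasureTheory Filter Topology
open scoped BigOperators Matrix.Norms.Frobenius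
open Literature.MathematicalPhysics.QuantumFieldTheory (GaugeConfig Site Edge lineHolonomy)
open Literature.MathematicalPhysics.QuantumLattice (secondCountableTopology_su2)
open Literature.MathematicalPhysics.QuantumFieldTheory.Balaban1983to89.B10Eq18SigmaSU2 (pauli)
open Literature.MathematicalPhysics.QuantumFieldTheory.Balaban1983to89.B10Eq18SigmaSU2Haar (expPauli expPauli_zero)
open Summit.QuantumFields.YangMills.Cruxes.CurvatureAmnesia.WardDefect.SchwingerDyson (hasDerivAt_reTrace)
open Summit.QuantumFields.YangMills.Theorems.EquipartitionPinsProbe.TangentSteinFiniteBeta (lipschitz_of_flow exists_abs_le_of_continuous)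

namespace Summit.QuantumFields.YangMills.Theorems.CovariantCurrentDoor

open Summit.QuantumFields.YangMills.Theorems.FemtoTransferGap
open Summit.QuantumFields.YangMills.Theorems.TransportField

variable {L : ℕ} [NeZero L]

/-! ## §0 Products of bounded measurable functions -/

/-- Integrability of a product of two bounded measurable functions (bounds given existentially). [folklore] -/
theorem integrable_mul_of_bdd' {f g : GaugeConfig 3 L SU2 → ℝ} (hf : Measurable f) (hg : Measurable g)
    (hbf : ∃ C : ℝ, ∀ U, |f U| ≤ C) (hbg : ∃ C : ℝ, ∀ U, |g U| ≤ C) : Integrable (fun U => f U * g U) (configMeasure SU2 L) := by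
  haveI : IsProbabilityMeasure (configMeasure SU2 L) := by unfold configMeasure; infer_instance
  obtain ⟨Cf, hCf⟩ := hbf
  obtain ⟨Cg, hCg⟩ := hbg
  refine Integrable.of_bound (hf.mul hg).aestronglyMeasurable (Cf * Cg) (ae_of_all _ fun U => ?_)
  rw [Real.norm_eq_abs, abs_mul]
  exact mul_le_mul (hCf U) (hCg U) (abs_nonneg _) ((abs_nonneg _).trans (hCf U))

/-- **Cauchy–Schwarz, squared form** for bounded measurable functions (bounds given existentially). [folklore] -/
theorem l2_sq_le_of_bdd' {f g : GaugeConfig 3 L SU2 → ℝ} (hf : Measurable f) (hg : Measurable g)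
    (hbf : ∃ C : ℝ, ∀ U, |f U| ≤ C) (hbg : ∃ C : ℝ, ∀ U, |g U| ≤ C) : l2 f g ^ 2 ≤ l2 f f * l2 g g := by
  have hff := integrable_mul_of_bdd' hf hf hbf hbf
  have hgg := integrable_mul_of_bdd' hg hg hbg hbg
  have hfg := integrable_mul_of_bdd' hf hg hbf hbg
  have hquad : ∀ t : ℝ, 0 ≤ l2 g g * (t * t) + (-(2 * l2 f g)) * t + l2 f f := by
    intro t
    have h0 : 0 ≤ ∫ U, (f U - t * g U) * (f U - t * g U) ∂configMeasure SU2 L := integral_nonneg fun U => mul_self_nonneg _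
    have hpt : (fun U => (f U - t * g U) * (f U - t * g U)) = fun U => t * t * (g U * g U) + -(2 * t) * (f U * g U) + f U * f U := by
      funext U; ring
    have i1 : Integrable (fun U => t * t * (g U * g U)) (configMeasure SU2 L) := hgg.const_mul _
    have i2 : Integrable (fun U => -(2 * t) * (f U * g U)) (configMeasure SU2 L) := hfg.const_mul _
    have i12 : Integrable (fun U => t * t * (g U * g U) + -(2 * t) * (f U * g U)) (configMeasure SU2 L) := i1.add i2
    rw [hpt, integral_add i12 hff, integral_add i1 i2, integral_const_mul, integral_const_mul] at h0
    unfold l2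
    linarith
  have hdisc := discrim_le_zero hquad
  rw [discrim] at hdisc
  nlinarith


/-! ## §1 The cross observable `G` along a right `expPauli` shift of a direction-`0` link -/

/-- **`G` is differentiable along the right shift of the link `(x,0)`, with a continuous derivative field** (the direction-`1` Polyakov lines are
constant along the shift, the direction-`0` ones are differentiable by kit tranche 5). [cite: Creutz2022, Ch. 11] -/
theorem exists_hasDerivAt_crossObs (x : Site 3 L) {a : GaugeConfig 3 L SU2 → EuclideanSpace ℝ (Fin 3)} (ha : Continuous a) :
    ∃ G' : GaugeConfig 3 L SU2 → ℝ, Continuous G' ∧ ∀ U : GaugeConfig 3 L SU2,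
      HasDerivAt (fun t : ℝ => (fun U : GaugeConfig 3 L SU2 => ∑ s : Site 3 L, (((su2Rep (polyakovSite s U ((0 : Site 3 1), (0 : Fin 3)) * (polyakovSite s U ((0 : Site 3 1), (1 : Fin 3)))⁻¹)).trace.re) ^ 2 - ((su2Rep (polyakovSite s U ((0 : Site 3 1), (0 : Fin 3)) * polyakovSite s U ((0 : Site 3 1), (1 : Fin 3)))).trace.re) ^ 2) / 16) (Function.update U (x, (0 : Fin 3)) (U (x, (0 : Fin 3)) * expPauli (t • a U))))
        (G' U) 0 := by
  classical
  choose D hDc hD using fun s : Site 3 L => exists_hasDerivAt_lineHolonomy (L := L) (x, (0 : Fin 3)) ha (0 : Fin 3) L s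
  -- the constant direction-1 lines
  have hP1 : ∀ (U : GaugeConfig 3 L SU2) (s : Site 3 L) (t : ℝ),
      polyakovSite s (Function.update U (x, (0 : Fin 3)) (U (x, (0 : Fin 3)) * expPauli (t • a U))) ((0 : Site 3 1), (1 : Fin 3)) = polyakovSite s U ((0 : Site 3 1), (1 : Fin 3)) := by
    intro U s t
    show lineHolonomy _ 1 L s = lineHolonomy U 1 L s
    exact lineHolonomy_update_of_ne (by decide) U x _ L s
  refine ⟨fun U => ∑ s : Site 3 L,
      (2 * (su2Rep (polyakovSite s U ((0 : Site 3 1), (0 : Fin 3))) * su2Rep (polyakovSite s U ((0 : Site 3 1), (1 : Fin 3)))⁻¹).trace.re * (D s U * su2Rep (polyakovSite s U ((0 : Site 3 1), (1 : Fin 3)))⁻¹).trace.re -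
        2 * (su2Rep (polyakovSite s U ((0 : Site 3 1), (0 : Fin 3))) * su2Rep (polyakovSite s U ((0 : Site 3 1), (1 : Fin 3)))).trace.re * (D s U * su2Rep (polyakovSite s U ((0 : Site 3 1), (1 : Fin 3)))).trace.re) / 16,
    ?_, fun U => ?_⟩
  · refine continuous_finsetSum _ fun s _ => ?_
    have h0 : Continuous fun U : GaugeConfig 3 L SU2 => su2Rep (polyakovSite s U ((0 : Site 3 1), (0 : Fin 3))) :=
      continuous_su2Rep.comp (continuous_lineHolonomy_apply 0 L s)
    have h1 : Continuous fun U : GaugeConfig 3 L SU2 => su2Rep (polyakovSite s U ((0 : Site 3 1), (1 : Fin 3))) :=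
      continuous_su2Rep.comp (continuous_lineHolonomy_apply 1 L s)
    have h1i : Continuous fun U : GaugeConfig 3 L SU2 => su2Rep (polyakovSite s U ((0 : Site 3 1), (1 : Fin 3)))⁻¹ :=
      continuous_su2Rep.comp (continuous_lineHolonomy_apply 1 L s).inv
    have hr : ∀ {f : GaugeConfig 3 L SU2 → Matrix (Fin 2) (Fin 2) ℂ}, Continuous f → Continuous fun U => (f U).trace.re :=
      fun hf => Complex.continuous_re.comp hf.matrix_trace
    exact ((((continuous_const.mul (hr (h0.mul h1i))).mul (hr ((hDc s).mul h1i))).sub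
      ((continuous_const.mul (hr (h0.mul h1))).mul (hr ((hDc s).mul h1)))).div_const _)
  · refine HasDerivAt.fun_sum fun s _ => ?_
    have h0 : Function.update U (x, (0 : Fin 3)) (U (x, (0 : Fin 3)) * expPauli ((0 : ℝ) • a U)) = U := by
      rw [zero_smul, expPauli_zero, mul_one, Function.update_eq_self]
    -- `t ↦ ρ(P₀(s)(U_t)) ρ(P₁(s))⁻¹` and `t ↦ ρ(P₀(s)(U_t)) ρ(P₁(s))`
    have hA := ((hD s U).mul_const (su2Rep (polyakovSite s U ((0 : Site 3 1), (1 : Fin 3)))⁻¹))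
    have hB := ((hD s U).mul_const (su2Rep (polyakovSite s U ((0 : Site 3 1), (1 : Fin 3)))))
    have hA' := ((hasDerivAt_reTrace hA).pow 2)
    have hB' := ((hasDerivAt_reTrace hB).pow 2)
    have h := (hA'.sub hB').div_const 16
    simp only [h0] at h
    have hline1 : ∀ y : SU2, lineHolonomy (Function.update U (x, (0 : Fin 3)) y) 1 L s = lineHolonomy U 1 L s :=
      fun y => lineHolonomy_update_of_ne (by decide) U x y L s
    refine (h.congr_of_eventuallyEq (Eventually.of_forall fun t => ?_)).congr_deriv ?_
    · simp only [Pi.pow_apply, Pi.sub_apply, map_mul, polyakovSite, hline1]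
    · simp only [polyakovSite, Nat.cast_ofNat, pow_one, Nat.add_one_sub_one]

/-! ## §2 Per-link integration by parts against `Ω²` for a general differentiable-Lipschitz observable -/

/-- **Integration by parts along a blind flow**: for a continuous `e`-blind direction field `a`, a physical vacuum `Ω`, and an observable `g`
that is continuous with a continuous derivative field `g'` along the flow, `∫ g' Ω² = −2 ∫ g Ω ∂Ω`. [cite: ReedSimonIV1978, Thm. XIII.43] -/
theorem integral_flowDeriv_vacuum_sq (β : ℝ) (e : Edge 3 L) {a : GaugeConfig 3 L SU2 → EuclideanSpace ℝ (Fin 3)}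
    (ha : Continuous a) (hblind : ∀ (U : GaugeConfig 3 L SU2) (y : SU2), a (Function.update U e y) = a U)
    {Ω : GaugeConfig 3 L SU2 → ℝ} (hΩ : IsPhys Ω) (heig : transferApply β Ω = topValue su2Rep L β • Ω)
    {g g' : GaugeConfig 3 L SU2 → ℝ} (hgc : Continuous g) (hg'c : Continuous g')
    (hg' : ∀ U, HasDerivAt (fun t : ℝ => g (Function.update U e (U e * expPauli (t • a U)))) (g' U) 0) :
    ∫ U, g' U * (Ω U * Ω U) ∂configMeasure SU2 L =
      -2 * ∫ U, g U * Ω U * deriv (fun t : ℝ => Ω (Function.update U e (U e * expPauli (t • a U)))) 0 ∂configMeasure SU2 L := by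
  haveI : SecondCountableTopology SU2 := secondCountableTopology_su2
  obtain ⟨Cg, hCg0, hCg⟩ := exists_abs_le_of_continuous hgc
  obtain ⟨Cg', hCg'0, hCg'⟩ := exists_abs_le_of_continuous hg'c
  obtain ⟨CΩ, hCΩ⟩ := hΩ.bounded
  have hCΩ0 : 0 ≤ CΩ := (abs_nonneg _).trans (hCΩ (fun _ : Edge 3 L => (1 : SU2)))
  obtain ⟨CdΩ, hCdΩ0, hCdΩ⟩ := bounded_deriv_vacuum_rightShift β e ha hΩ heig
  set T : ℝ → GaugeConfig 3 L SU2 → GaugeConfig 3 L SU2 := fun t U => Function.update U e (U e * expPauli (t • a U)) with hT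
  have hflow : ∀ s t U, T (t + s) U = T t (T s U) := fun s t U => update_expPauli_flow e hblind s t U
  have hT0 : ∀ U, T 0 U = U := fun U => by simp only [hT, zero_smul, expPauli_zero, mul_one, Function.update_eq_self]
  have hdΩ : ∀ U, HasDerivAt (fun t => Ω (T t U)) (deriv (fun t : ℝ => Ω (Function.update U e (U e * expPauli (t • a U)))) 0) 0 :=
    fun U => (differentiableAt_vacuum_rightShift β e (a U) hΩ heig U).hasDerivAt
  have hΩlip : ∀ U t s, |Ω (T t U) - Ω (T s U)| ≤ CdΩ * |t - s| := fun U t s => lipschitz_of_flow T hflow Ω _ hdΩ hCdΩ U t s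
  have hglip : ∀ U t s, |g (T t U) - g (T s U)| ≤ Cg' * |t - s| := fun U t s => lipschitz_of_flow T hflow g g' hg' hCg' U t s
  -- `G = g Ω²`
  have hGm : Measurable fun U => g U * (Ω U * Ω U) := hgc.measurable.mul (hΩ.measurable.mul hΩ.measurable)
  have hGb : ∀ U, |g U * (Ω U * Ω U)| ≤ Cg * (CΩ * CΩ) := fun U => by
    rw [abs_mul, abs_mul]
    exact mul_le_mul (hCg U) (mul_le_mul (hCΩ U) (hCΩ U) (abs_nonneg _) hCΩ0) (mul_nonneg (abs_nonneg _) (abs_nonneg _)) hCg0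
  have hGlip : ∀ (t : ℝ) (U : GaugeConfig 3 L SU2),
      |g (Function.update U e (U e * expPauli (t • a U))) *
          (Ω (Function.update U e (U e * expPauli (t • a U))) * Ω (Function.update U e (U e * expPauli (t • a U)))) -
        g U * (Ω U * Ω U)| ≤ (Cg' * (CΩ * CΩ) + Cg * (2 * CΩ * CdΩ)) * |t| := by
    intro t U
    have hg1 := hglip U t 0
    have hΩ1 := hΩlip U t 0
    rw [hT0 U, sub_zero] at hg1 hΩ1
    show |g (T t U) * (Ω (T t U) * Ω (T t U)) - g U * (Ω U * Ω U)| ≤ _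
    have hsplit : g (T t U) * (Ω (T t U) * Ω (T t U)) - g U * (Ω U * Ω U) =
        (g (T t U) - g U) * (Ω (T t U) * Ω (T t U)) + g U * ((Ω (T t U) + Ω U) * (Ω (T t U) - Ω U)) := by ring
    rw [hsplit]
    refine (abs_add_le _ _).trans ?_
    rw [abs_mul, abs_mul, abs_mul, abs_mul, add_mul]
    refine add_le_add ?_ ?_
    · calc |g (T t U) - g U| * (|Ω (T t U)| * |Ω (T t U)|)
          ≤ Cg' * |t| * (CΩ * CΩ) := mul_le_mul hg1 (mul_le_mul (hCΩ _) (hCΩ _) (abs_nonneg _) hCΩ0)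
              (mul_nonneg (abs_nonneg _) (abs_nonneg _)) (by positivity)
        _ = Cg' * (CΩ * CΩ) * |t| := by ring
    · have h2 : |Ω (T t U) + Ω U| ≤ 2 * CΩ := (abs_add_le _ _).trans (by linarith [hCΩ (T t U), hCΩ U])
      calc |g U| * (|Ω (T t U) + Ω U| * |Ω (T t U) - Ω U|)
          ≤ Cg * (2 * CΩ * (CdΩ * |t|)) := mul_le_mul (hCg U) (mul_le_mul h2 hΩ1 (abs_nonneg _) (by positivity))
              (mul_nonneg (abs_nonneg _) (abs_nonneg _)) hCg0
        _ = Cg * (2 * CΩ * CdΩ) * |t| := by ring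
  have hGd : ∀ U : GaugeConfig 3 L SU2, DifferentiableAt ℝ (fun t : ℝ =>
      g (Function.update U e (U e * expPauli (t • a U))) *
        (Ω (Function.update U e (U e * expPauli (t • a U))) * Ω (Function.update U e (U e * expPauli (t • a U))))) 0 :=
    fun U => (hg' U).differentiableAt.mul
      ((differentiableAt_vacuum_rightShift β e (a U) hΩ heig U).mul (differentiableAt_vacuum_rightShift β e (a U) hΩ heig U))
  have hzero := integral_deriv_flow_eq_zero e ha.measurable hblind hGm hGb hGlip hGd
  have hderiv : ∀ U : GaugeConfig 3 L SU2, deriv (fun t : ℝ =>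
      g (Function.update U e (U e * expPauli (t • a U))) *
        (Ω (Function.update U e (U e * expPauli (t • a U))) * Ω (Function.update U e (U e * expPauli (t • a U))))) 0 =
      g' U * (Ω U * Ω U) + 2 * (g U * Ω U * deriv (fun t : ℝ => Ω (Function.update U e (U e * expPauli (t • a U)))) 0) := by
    intro U
    have h := (hg' U).fun_mul ((hdΩ U).fun_mul (hdΩ U))
    simp only [hT, zero_smul, expPauli_zero, mul_one, Function.update_eq_self] at h
    rw [h.deriv]; ring
  have hi1 : Integrable (fun U => g' U * (Ω U * Ω U)) (configMeasure SU2 L) :=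
    integrable_mul_of_bdd' hg'c.measurable (hΩ.measurable.mul hΩ.measurable) ⟨Cg', hCg'⟩
      ⟨CΩ * CΩ, fun U => by rw [abs_mul]; exact mul_le_mul (hCΩ U) (hCΩ U) (abs_nonneg _) hCΩ0⟩
  have hi2 : Integrable (fun U => g U * Ω U * deriv (fun t : ℝ => Ω (Function.update U e (U e * expPauli (t • a U)))) 0)
      (configMeasure SU2 L) :=
    integrable_mul_of_bdd' (hgc.measurable.mul hΩ.measurable) (measurable_deriv_vacuum_rightShift β e ha hΩ heig)
      ⟨Cg * CΩ, fun U => by rw [abs_mul]; exact mul_le_mul (hCg U) (hCΩ U) (abs_nonneg _) hCg0⟩ ⟨CdΩ, hCdΩ⟩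
  simp only [hderiv] at hzero
  rw [integral_add hi1 (hi2.const_mul 2), integral_const_mul] at hzero
  linarith

/-! ## §3 The registered stub -/

/-- The registered stub statement `RobertsonBP` of line `birth` of crux ⟨stmt-QuantumFields-23380⟩ (verbatim copy of the skeleton's
`BirthCNF.RobertsonBP`; a registered-stub copy, not a citable fact). -/
abbrev RobertsonBP : Prop :=
  ∀ β : ℝ, 0 < β → ∀ (L : ℕ) [NeZero L], ∀ Ω : Literature.MathematicalPhysics.QuantumFieldTheory.GaugeConfig 3 L SU2 → ℝ, IsPhys Ω → l2 Ω Ω = 1 → transferApply β Ω = topValue su2Rep L β • Ω → let P : Literature.MathematicalPhysics.QuantumFieldTheory.Site 3 L → Literature.MathematicalPhysics.QuantumFieldTheory.GaugeConfig 3 L SU2 → SU2 := fun s U => polyakovSite s U ((0 : Literature.MathematicalPhysics.QuantumFieldTheory.Site 3 1), (1 : Fin 3)); let M₀ : Literature.MathematicalPhysics.QuantumFieldTheory.GaugeConfig 3 L SU2 → Literature.MathematicalPhysics.QuantumFieldTheory.Site 3 L → Matrix (Fin 2) (Fin 2) ℂ := fun U s => ((su2Rep (P s U)).trace.re : ℂ)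 • ((1 / 2 : ℂ) • (su2Rep (P s U) - su2Rep (P s U)⁻¹)); let T : Literature.MathematicalPhysics.QuantumFieldTheory.GaugeConfig 3 L SU2 → (Literature.MathematicalPhysics.QuantumFieldTheory.Site 3 L → Matrix (Fin 2) (Fin 2) ℂ) → Literature.MathematicalPhysics.QuantumFieldTheory.Site 3 L → Matrix (Fin 2) (Fin 2) ℂ := fun U m s => (1 / 5 : ℂ) • (m s + ∑ i ∈ ({1, 2} : Finset (Fin 3)), (su2Rep (U (s, i)) * m (s.shift i) * su2Rep (U (s, i))⁻¹ + su2Rep (U (s - Pi.single i 1, i))⁻¹ * m (s - Pi.single i 1) * su2Rep (U (s - Pi.single i 1, i)))); let B : Literature.MathematicalPhysics.QuantumFieldTheory.GaugeConfig 3 L SU2 → Literature.MathematicalPhysics.QuantumFieldTheory.Site 3 L → Matrix (Fin 2) (Fin 2) ℂ := fun U => (T U)^[L ^ 2 * (⌈Real.log β⌉₊ + 1)] (M₀ U); let b : Literature.MathematicalPhysics.QuantumFieldTheory.Site 3 L → Literature.MathematicalPhysics.QuantumFieldTheory.GaugeConfig 3 L SU2 → EuclideanSpace ℝ (Fin 3)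 := fun s U => (EuclideanSpace.equiv (Fin 3) ℝ).symm fun a => (-(Complex.I / 2) * (Literature.MathematicalPhysics.QuantumFieldTheory.Balaban1983to89.B10Eq18SigmaSU2.pauli a * B U s).trace).re; let X : (Literature.MathematicalPhysics.QuantumFieldTheory.GaugeConfig 3 L SU2 → ℝ) → Literature.MathematicalPhysics.QuantumFieldTheory.GaugeConfig 3 L SU2 → ℝ := fun ψ U => ∑ x : Literature.MathematicalPhysics.QuantumFieldTheory.Site 3 L, deriv (fun t : ℝ => ψ (Function.update U (x, (0 : Fin 3)) (U (x, (0 : Fin 3)) * Literature.MathematicalPhysics.QuantumFieldTheory.Balaban1983to89.B10Eq18SigmaSU2Haar.expPauli (t • b (x.shift 0) U)))) 0; let P0 : Literature.MathematicalPhysics.QuantumFieldTheory.Site 3 L → Literature.MathematicalPhysics.QuantumFieldTheory.GaugeConfig 3 L SU2 → SU2 := fun s U => polyakovSite s U ((0 : Literature.MathematicalPhysics.QuantumFieldTheory.Site 3 1), (0 : Fin 3)); let G : Literature.MathematicalPhysics.QuantumFieldTheory.GaugeConfig 3 L SU2 → ℝ := fun U => ∑ s : Literature.MathematicalPhysics.QuantumFieldTheory.Site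 3 L, (((su2Rep (P0 s U * (P s U)⁻¹)).trace.re) ^ 2 - ((su2Rep (P0 s U * P s U)).trace.re) ^ 2) / 16; (l2 (fun U => X G U * Ω U) Ω) ^ 2 ≤ 4 * l2 (X Ω) (X Ω) * l2 (fun U => G U * Ω U) (fun U => G U * Ω U)

/-- ★★ **`stub_robertsonB`** (registered stub of the birth skeleton of crux ⟨stmt-QuantumFields-23380⟩, signature `RobertsonBP` verbatim):
`⟨(XG)Ω, Ω⟩² ≤ 4‖XΩ‖²‖GΩ‖²`. [cite: ReedSimonIV1978, Thm. XIII.43] [cite: Creutz2022, Ch. 11] -/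
theorem stub_robertsonB : RobertsonBP := by
  intro β _hβ L _ Ω hΩ _hn heig
  dsimp only
  haveI : SecondCountableTopology SU2 := secondCountableTopology_su2
  -- direction fields: continuous and blind
  have hB := continuous_smoothedField (L := L) (L ^ 2 * (⌈Real.log β⌉₊ + 1))
  have hdir : ∀ x : Site 3 L, Continuous fun U : GaugeConfig 3 L SU2 => ((EuclideanSpace.equiv (Fin 3) ℝ).symm fun a => (-(Complex.I / 2) * (pauli a * (((fun m : Site 3 L → Matrix (Fin 2) (Fin 2) ℂ => fun s : Site 3 L =>
          (1 / 5 : ℂ) • (m s + ∑ i ∈ ({1, 2} : Finset (Fin 3)),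
            (su2Rep (U (s, i)) * m (s.shift i) * su2Rep (U (s, i))⁻¹ +
              su2Rep (U (s - Pi.single i 1, i))⁻¹ * m (s - Pi.single i 1) * su2Rep (U (s - Pi.single i 1, i))))))^[L ^ 2 * (⌈Real.log β⌉₊ + 1)] (fun s : Site 3 L =>
          ((su2Rep (polyakovSite s U ((0 : Site 3 1), (1 : Fin 3)))).trace.re : ℂ) •
            ((1 / 2 : ℂ) • (su2Rep (polyakovSite s U ((0 : Site 3 1), (1 : Fin 3))) - su2Rep (polyakovSite s U ((0 : Site 3 1), (1 : Fin 3)))⁻¹))) ((x).shift 0))).trace).re) :=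
    fun x => continuous_colourOf ((continuous_apply (x.shift 0)).comp hB)
  have hblind : ∀ (x : Site 3 L) (U : GaugeConfig 3 L SU2) (y : SU2),
      ((EuclideanSpace.equiv (Fin 3) ℝ).symm fun a => (-(Complex.I / 2) * (pauli a * (((fun m : Site 3 L → Matrix (Fin 2) (Fin 2) ℂ => fun s : Site 3 L =>
          (1 / 5 : ℂ) • (m s + ∑ i ∈ ({1, 2} : Finset (Fin 3)),
            (su2Rep ((Function.update U (x, (0 : Fin 3)) y) (s, i)) * m (s.shift i) * su2Rep ((Function.update U (x, (0 : Fin 3)) y) (s, i))⁻¹ +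
              su2Rep ((Function.update U (x, (0 : Fin 3)) y) (s - Pi.single i 1, i))⁻¹ * m (s - Pi.single i 1) * su2Rep ((Function.update U (x, (0 : Fin 3)) y) (s - Pi.single i 1, i))))))^[L ^ 2 * (⌈Real.log β⌉₊ + 1)] (fun s : Site 3 L =>
          ((su2Rep (polyakovSite s (Function.update U (x, (0 : Fin 3)) y) ((0 : Site 3 1), (1 : Fin 3)))).trace.re : ℂ) •
            ((1 / 2 : ℂ) • (su2Rep (polyakovSite s (Function.update U (x, (0 : Fin 3)) y) ((0 : Site 3 1), (1 : Fin 3))) - su2Rep (polyakovSite s (Function.update U (x, (0 : Fin 3)) y) ((0 : Site 3 1), (1 : Fin 3)))⁻¹))) ((x).shift 0))).trace).re) = ((EuclideanSpace.equiv (Fin 3) ℝ).symm fun a => (-(Complex.I / 2) * (pauli a * (((fun m : Site 3 L → Matrix (Fin 2) (Fin 2) ℂ => fun s : Site 3 L =>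
          (1 / 5 : ℂ) • (m s + ∑ i ∈ ({1, 2} : Finset (Fin 3)),
            (su2Rep (U (s, i)) * m (s.shift i) * su2Rep (U (s, i))⁻¹ +
              su2Rep (U (s - Pi.single i 1, i))⁻¹ * m (s - Pi.single i 1) * su2Rep (U (s - Pi.single i 1, i))))))^[L ^ 2 * (⌈Real.log β⌉₊ + 1)] (fun s : Site 3 L =>
          ((su2Rep (polyakovSite s U ((0 : Site 3 1), (1 : Fin 3)))).trace.re : ℂ) •
            ((1 / 2 : ℂ) • (su2Rep (polyakovSite s U ((0 : Site 3 1), (1 : Fin 3))) - su2Rep (polyakovSite s U ((0 : Site 3 1), (1 : Fin 3)))⁻¹))) ((x).shift 0))).trace).re) := by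
    intro x U y; rw [smoothedField_update_dir0]
  -- the observable `G`: continuous, differentiable along each flow
  have hGc : Continuous (fun U : GaugeConfig 3 L SU2 => ∑ s : Site 3 L, (((su2Rep (polyakovSite s U ((0 : Site 3 1), (0 : Fin 3)) * (polyakovSite s U ((0 : Site 3 1), (1 : Fin 3)))⁻¹)).trace.re) ^ 2 - ((su2Rep (polyakovSite s U ((0 : Site 3 1), (0 : Fin 3)) * polyakovSite s U ((0 : Site 3 1), (1 : Fin 3)))).trace.re) ^ 2) / 16) := by
    refine continuous_finsetSum _ fun s _ => ?_
    have h0 : Continuous fun U : GaugeConfig 3 L SU2 => polyakovSite s U ((0 : Site 3 1), (0 : Fin 3)) := continuous_lineHolonomy_apply 0 L s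
    have h1 : Continuous fun U : GaugeConfig 3 L SU2 => polyakovSite s U ((0 : Site 3 1), (1 : Fin 3)) := continuous_lineHolonomy_apply 1 L s
    have hr : ∀ {f : GaugeConfig 3 L SU2 → SU2}, Continuous f → Continuous fun U => (su2Rep (f U)).trace.re :=
      fun hf => Complex.continuous_re.comp (continuous_su2Rep.comp hf).matrix_trace
    refine Continuous.div_const ?_ _
    exact ((hr (h0.mul h1.inv)).pow 2).sub ((hr (h0.mul h1)).pow 2)
  obtain ⟨CG, hCG0, hCG⟩ := exists_abs_le_of_continuous hGc
  obtain ⟨CΩ, hCΩ⟩ := hΩ.bounded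
  have hCΩ0 : 0 ≤ CΩ := (abs_nonneg _).trans (hCΩ (fun _ : Edge 3 L => (1 : SU2)))
  -- per-site identities
  have hx : ∀ x : Site 3 L, ∃ G' : GaugeConfig 3 L SU2 → ℝ, Continuous G' ∧
      (∀ U, HasDerivAt (fun t : ℝ => (fun U : GaugeConfig 3 L SU2 => ∑ s : Site 3 L, (((su2Rep (polyakovSite s U ((0 : Site 3 1), (0 : Fin 3)) * (polyakovSite s U ((0 : Site 3 1), (1 : Fin 3)))⁻¹)).trace.re) ^ 2 - ((su2Rep (polyakovSite s U ((0 : Site 3 1), (0 : Fin 3)) * polyakovSite s U ((0 : Site 3 1), (1 : Fin 3)))).trace.re) ^ 2) / 16) (Function.update U (x, (0 : Fin 3)) (U (x, (0 : Fin 3)) * expPauli (t • ((EuclideanSpace.equiv (Fin 3) ℝ).symm fun a => (-(Complex.I / 2) * (pauli a * (((fun m : Site 3 L → Matrix (Fin 2) (Fin 2) ℂ => fun s : Site 3 L =>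
          (1 / 5 : ℂ) • (m s + ∑ i ∈ ({1, 2} : Finset (Fin 3)),
            (su2Rep (U (s, i)) * m (s.shift i) * su2Rep (U (s, i))⁻¹ +
              su2Rep (U (s - Pi.single i 1, i))⁻¹ * m (s - Pi.single i 1) * su2Rep (U (s - Pi.single i 1, i))))))^[L ^ 2 * (⌈Real.log β⌉₊ + 1)] (fun s : Site 3 L =>
          ((su2Rep (polyakovSite s U ((0 : Site 3 1), (1 : Fin 3)))).trace.re : ℂ) •
            ((1 / 2 : ℂ) • (su2Rep (polyakovSite s U ((0 : Site 3 1), (1 : Fin 3))) - su2Rep (polyakovSite s U ((0 : Site 3 1), (1 : Fin 3)))⁻¹))) ((x).shift 0))).trace).re)))))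
        (G' U) 0) ∧
      ∫ U, G' U * (Ω U * Ω U) ∂configMeasure SU2 L =
        -2 * ∫ U, (fun U : GaugeConfig 3 L SU2 => ∑ s : Site 3 L, (((su2Rep (polyakovSite s U ((0 : Site 3 1), (0 : Fin 3)) * (polyakovSite s U ((0 : Site 3 1), (1 : Fin 3)))⁻¹)).trace.re) ^ 2 - ((su2Rep (polyakovSite s U ((0 : Site 3 1), (0 : Fin 3)) * polyakovSite s U ((0 : Site 3 1), (1 : Fin 3)))).trace.re) ^ 2) / 16) U * Ω U * deriv (fun t : ℝ => Ω (Function.update U (x, (0 : Fin 3)) (U (x, (0 : Fin 3)) * expPauli (t • ((EuclideanSpace.equiv (Fin 3) ℝ).symm fun a => (-(Complex.I / 2) * (pauli a * (((fun m : Site 3 L → Matrix (Fin 2) (Fin 2) ℂ => fun s : Site 3 L =>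
          (1 / 5 : ℂ) • (m s + ∑ i ∈ ({1, 2} : Finset (Fin 3)),
            (su2Rep (U (s, i)) * m (s.shift i) * su2Rep (U (s, i))⁻¹ +
              su2Rep (U (s - Pi.single i 1, i))⁻¹ * m (s - Pi.single i 1) * su2Rep (U (s - Pi.single i 1, i))))))^[L ^ 2 * (⌈Real.log β⌉₊ + 1)] (fun s : Site 3 L =>
          ((su2Rep (polyakovSite s U ((0 : Site 3 1), (1 : Fin 3)))).trace.re : ℂ) •
            ((1 / 2 : ℂ) • (su2Rep (polyakovSite s U ((0 : Site 3 1), (1 : Fin 3))) - su2Rep (polyakovSite s U ((0 : Site 3 1), (1 : Fin 3)))⁻¹))) ((x).shift 0))).trace).re))))) 0 ∂configMeasure SU2 L := by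
    intro x
    obtain ⟨G', hG'c, hG'⟩ := exists_hasDerivAt_crossObs x (hdir x)
    exact ⟨G', hG'c, hG', integral_flowDeriv_vacuum_sq β (x, (0 : Fin 3)) (hdir x) (hblind x) hΩ heig hGc hG'c hG'⟩
  choose G' hG'c hG' hint using hx
  -- `XG = Σ_x G'_x`, `XΩ` continuous
  have hXG : ∀ U : GaugeConfig 3 L SU2, (∑ x : Site 3 L, deriv (fun t : ℝ => (fun U : GaugeConfig 3 L SU2 => ∑ s : Site 3 L, (((su2Rep (polyakovSite s U ((0 : Site 3 1), (0 : Fin 3)) * (polyakovSite s U ((0 : Site 3 1), (1 : Fin 3)))⁻¹)).trace.re) ^ 2 - ((su2Rep (polyakovSite s U ((0 : Site 3 1), (0 : Fin 3)) * polyakovSite s U ((0 : Site 3 1), (1 : Fin 3)))).trace.re) ^ 2) / 16) (Function.update U (x, (0 : Fin 3)) (U (x, (0 : Fin 3)) * expPauli (t • ((EuclideanSpace.equiv (Fin 3) ℝ).symm fun a => (-(Complex.I / 2) * (pauli a * (((fun m : Site 3 L → Matrix (Fin 2) (Fin 2) ℂ => fun s : Site 3 L =>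
          (1 / 5 : ℂ) • (m s + ∑ i ∈ ({1, 2} : Finset (Fin 3)),
            (su2Rep (U (s, i)) * m (s.shift i) * su2Rep (U (s, i))⁻¹ +
              su2Rep (U (s - Pi.single i 1, i))⁻¹ * m (s - Pi.single i 1) * su2Rep (U (s - Pi.single i 1, i))))))^[L ^ 2 * (⌈Real.log β⌉₊ + 1)] (fun s : Site 3 L =>
          ((su2Rep (polyakovSite s U ((0 : Site 3 1), (1 : Fin 3)))).trace.re : ℂ) •
            ((1 / 2 : ℂ) • (su2Rep (polyakovSite s U ((0 : Site 3 1), (1 : Fin 3))) - su2Rep (polyakovSite s U ((0 : Site 3 1), (1 : Fin 3)))⁻¹))) ((x).shift 0))).trace).re))))) 0) = ∑ x : Site 3 L, G' x U :=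
    fun U => Finset.sum_congr rfl fun x _ => (hG' x U).deriv
  have hXΩc : Continuous fun U : GaugeConfig 3 L SU2 => ∑ x : Site 3 L, deriv (fun t : ℝ => Ω (Function.update U (x, (0 : Fin 3)) (U (x, (0 : Fin 3)) * expPauli (t • ((EuclideanSpace.equiv (Fin 3) ℝ).symm fun a => (-(Complex.I / 2) * (pauli a * (((fun m : Site 3 L → Matrix (Fin 2) (Fin 2) ℂ => fun s : Site 3 L =>
          (1 / 5 : ℂ) • (m s + ∑ i ∈ ({1, 2} : Finset (Fin 3)),
            (su2Rep (U (s, i)) * m (s.shift i) * su2Rep (U (s, i))⁻¹ +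
              su2Rep (U (s - Pi.single i 1, i))⁻¹ * m (s - Pi.single i 1) * su2Rep (U (s - Pi.single i 1, i))))))^[L ^ 2 * (⌈Real.log β⌉₊ + 1)] (fun s : Site 3 L =>
          ((su2Rep (polyakovSite s U ((0 : Site 3 1), (1 : Fin 3)))).trace.re : ℂ) •
            ((1 / 2 : ℂ) • (su2Rep (polyakovSite s U ((0 : Site 3 1), (1 : Fin 3))) - su2Rep (polyakovSite s U ((0 : Site 3 1), (1 : Fin 3)))⁻¹))) ((x).shift 0))).trace).re))))) 0 :=
    continuous_finsetSum _ fun x _ => continuous_deriv_vacuum_rightShift β (x, (0 : Fin 3)) (hdir x) hΩ heig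
  obtain ⟨CX, hCX0, hCX⟩ := exists_abs_le_of_continuous hXΩc
  have hi1 : ∀ x : Site 3 L, Integrable (fun U => G' x U * (Ω U * Ω U)) (configMeasure SU2 L) := by
    intro x
    obtain ⟨C', -, hC'⟩ := exists_abs_le_of_continuous (hG'c x)
    exact integrable_mul_of_bdd' (hG'c x).measurable (hΩ.measurable.mul hΩ.measurable) ⟨C', hC'⟩
      ⟨CΩ * CΩ, fun U => by rw [abs_mul]; exact mul_le_mul (hCΩ U) (hCΩ U) (abs_nonneg _) hCΩ0⟩
  have hgm : Measurable fun U => (fun U : GaugeConfig 3 L SU2 => ∑ s : Site 3 L, (((su2Rep (polyakovSite s U ((0 : Site 3 1), (0 : Fin 3)) * (polyakovSite s U ((0 : Site 3 1), (1 : Fin 3)))⁻¹)).trace.re) ^ 2 - ((su2Rep (polyakovSite s U ((0 : Site 3 1), (0 : Fin 3)) * polyakovSite s U ((0 : Site 3 1), (1 : Fin 3)))).trace.re) ^ 2) / 16) U * Ω U := hGc.measurable.mul hΩ.measurable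
  have hgb : ∀ U, |(fun U : GaugeConfig 3 L SU2 => ∑ s : Site 3 L, (((su2Rep (polyakovSite s U ((0 : Site 3 1), (0 : Fin 3)) * (polyakovSite s U ((0 : Site 3 1), (1 : Fin 3)))⁻¹)).trace.re) ^ 2 - ((su2Rep (polyakovSite s U ((0 : Site 3 1), (0 : Fin 3)) * polyakovSite s U ((0 : Site 3 1), (1 : Fin 3)))).trace.re) ^ 2) / 16) U * Ω U| ≤ CG * CΩ := fun U => by
    rw [abs_mul]; exact mul_le_mul (hCG U) (hCΩ U) (abs_nonneg _) hCG0
  have hi2 : ∀ x : Site 3 L, Integrable (fun U => (fun U : GaugeConfig 3 L SU2 => ∑ s : Site 3 L, (((su2Rep (polyakovSite s U ((0 : Site 3 1), (0 : Fin 3)) * (polyakovSite s U ((0 : Site 3 1), (1 : Fin 3)))⁻¹)).trace.re) ^ 2 - ((su2Rep (polyakovSite s U ((0 : Site 3 1), (0 : Fin 3)) * polyakovSite s U ((0 : Site 3 1), (1 : Fin 3)))).trace.re) ^ 2) / 16) U * Ω U * deriv (fun t : ℝ => Ω (Function.update U (x, (0 : Fin 3)) (U (x, (0 : Fin 3)) *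 expPauli (t • ((EuclideanSpace.equiv (Fin 3) ℝ).symm fun a => (-(Complex.I / 2) * (pauli a * (((fun m : Site 3 L → Matrix (Fin 2) (Fin 2) ℂ => fun s : Site 3 L =>
          (1 / 5 : ℂ) • (m s + ∑ i ∈ ({1, 2} : Finset (Fin 3)),
            (su2Rep (U (s, i)) * m (s.shift i) * su2Rep (U (s, i))⁻¹ +
              su2Rep (U (s - Pi.single i 1, i))⁻¹ * m (s - Pi.single i 1) * su2Rep (U (s - Pi.single i 1, i))))))^[L ^ 2 * (⌈Real.log β⌉₊ + 1)] (fun s : Site 3 L =>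
          ((su2Rep (polyakovSite s U ((0 : Site 3 1), (1 : Fin 3)))).trace.re : ℂ) •
            ((1 / 2 : ℂ) • (su2Rep (polyakovSite s U ((0 : Site 3 1), (1 : Fin 3))) - su2Rep (polyakovSite s U ((0 : Site 3 1), (1 : Fin 3)))⁻¹))) ((x).shift 0))).trace).re))))) 0) (configMeasure SU2 L) := by
    intro x
    obtain ⟨Cd, -, hCd⟩ := bounded_deriv_vacuum_rightShift β (x, (0 : Fin 3)) (hdir x) hΩ heig
    exact integrable_mul_of_bdd' hgm (measurable_deriv_vacuum_rightShift β (x, (0 : Fin 3)) (hdir x) hΩ heig) ⟨_, hgb⟩ ⟨Cd, hCd⟩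
  -- `⟨(XG)Ω, Ω⟩ = −2 ⟨GΩ, XΩ⟩`
  have hkey : l2 (fun U => (∑ x : Site 3 L, deriv (fun t : ℝ => (fun U : GaugeConfig 3 L SU2 => ∑ s : Site 3 L, (((su2Rep (polyakovSite s U ((0 : Site 3 1), (0 : Fin 3)) * (polyakovSite s U ((0 : Site 3 1), (1 : Fin 3)))⁻¹)).trace.re) ^ 2 - ((su2Rep (polyakovSite s U ((0 : Site 3 1), (0 : Fin 3)) * polyakovSite s U ((0 : Site 3 1), (1 : Fin 3)))).trace.re) ^ 2) / 16) (Function.update U (x, (0 : Fin 3)) (U (x, (0 : Fin 3)) * expPauli (t • ((EuclideanSpace.equiv (Fin 3) ℝ).symm fun a => (-(Complex.I / 2) * (pauli a * (((fun m : Site 3 L → Matrix (Fin 2) (Fin 2) ℂ => fun s : Site 3 L =>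
          (1 / 5 : ℂ) • (m s + ∑ i ∈ ({1, 2} : Finset (Fin 3)),
            (su2Rep (U (s, i)) * m (s.shift i) * su2Rep (U (s, i))⁻¹ +
              su2Rep (U (s - Pi.single i 1, i))⁻¹ * m (s - Pi.single i 1) * su2Rep (U (s - Pi.single i 1, i))))))^[L ^ 2 * (⌈Real.log β⌉₊ + 1)] (fun s : Site 3 L =>
          ((su2Rep (polyakovSite s U ((0 : Site 3 1), (1 : Fin 3)))).trace.re : ℂ) •
            ((1 / 2 : ℂ) • (su2Rep (polyakovSite s U ((0 : Site 3 1), (1 : Fin 3))) - su2Rep (polyakovSite s U ((0 : Site 3 1), (1 : Fin 3)))⁻¹))) ((x).shift 0))).trace).re))))) 0) * Ω U) Ω =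
      -2 * l2 (fun U => (fun U : GaugeConfig 3 L SU2 => ∑ s : Site 3 L, (((su2Rep (polyakovSite s U ((0 : Site 3 1), (0 : Fin 3)) * (polyakovSite s U ((0 : Site 3 1), (1 : Fin 3)))⁻¹)).trace.re) ^ 2 - ((su2Rep (polyakovSite s U ((0 : Site 3 1), (0 : Fin 3)) * polyakovSite s U ((0 : Site 3 1), (1 : Fin 3)))).trace.re) ^ 2) / 16) U * Ω U) (fun U => ∑ x : Site 3 L, deriv (fun t : ℝ => Ω (Function.update U (x, (0 : Fin 3)) (U (x, (0 : Fin 3)) * expPauli (t • ((EuclideanSpace.equiv (Fin 3) ℝ).symm fun a => (-(Complex.I / 2) * (pauli a * (((fun m : Site 3 L → Matrix (Fin 2) (Fin 2) ℂ => fun s : Site 3 L =>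
          (1 / 5 : ℂ) • (m s + ∑ i ∈ ({1, 2} : Finset (Fin 3)),
            (su2Rep (U (s, i)) * m (s.shift i) * su2Rep (U (s, i))⁻¹ +
              su2Rep (U (s - Pi.single i 1, i))⁻¹ * m (s - Pi.single i 1) * su2Rep (U (s - Pi.single i 1, i))))))^[L ^ 2 * (⌈Real.log β⌉₊ + 1)] (fun s : Site 3 L =>
          ((su2Rep (polyakovSite s U ((0 : Site 3 1), (1 : Fin 3)))).trace.re : ℂ) •
            ((1 / 2 : ℂ) • (su2Rep (polyakovSite s U ((0 : Site 3 1), (1 : Fin 3))) - su2Rep (polyakovSite s U ((0 : Site 3 1), (1 : Fin 3)))⁻¹))) ((x).shift 0))).trace).re))))) 0) := by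
    unfold l2
    rw [show (fun U => (∑ x : Site 3 L, deriv (fun t : ℝ => (fun U : GaugeConfig 3 L SU2 => ∑ s : Site 3 L, (((su2Rep (polyakovSite s U ((0 : Site 3 1), (0 : Fin 3)) * (polyakovSite s U ((0 : Site 3 1), (1 : Fin 3)))⁻¹)).trace.re) ^ 2 - ((su2Rep (polyakovSite s U ((0 : Site 3 1), (0 : Fin 3)) * polyakovSite s U ((0 : Site 3 1), (1 : Fin 3)))).trace.re) ^ 2) / 16) (Function.update U (x, (0 : Fin 3)) (U (x, (0 : Fin 3)) * expPauli (t • ((EuclideanSpace.equiv (Fin 3) ℝ).symm fun a => (-(Complex.I / 2) * (pauli a * (((fun m : Site 3 L → Matrix (Fin 2) (Fin 2) ℂ => fun s : Site 3 L =>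
          (1 / 5 : ℂ) • (m s + ∑ i ∈ ({1, 2} : Finset (Fin 3)),
            (su2Rep (U (s, i)) * m (s.shift i) * su2Rep (U (s, i))⁻¹ +
              su2Rep (U (s - Pi.single i 1, i))⁻¹ * m (s - Pi.single i 1) * su2Rep (U (s - Pi.single i 1, i))))))^[L ^ 2 * (⌈Real.log β⌉₊ + 1)] (fun s : Site 3 L =>
          ((su2Rep (polyakovSite s U ((0 : Site 3 1), (1 : Fin 3)))).trace.re : ℂ) •
            ((1 / 2 : ℂ) • (su2Rep (polyakovSite s U ((0 : Site 3 1), (1 : Fin 3))) - su2Rep (polyakovSite s U ((0 : Site 3 1), (1 : Fin 3)))⁻¹))) ((x).shift 0))).trace).re))))) 0) * Ω U * Ω U) = fun U => ∑ x : Site 3 L, G' x U * (Ω U * Ω U) from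
      funext fun U => by rw [hXG U, Finset.sum_mul, Finset.sum_mul]; simp only [mul_assoc], integral_finsetSum _ fun x _ => hi1 x]
    rw [show (fun U => (fun U : GaugeConfig 3 L SU2 => ∑ s : Site 3 L, (((su2Rep (polyakovSite s U ((0 : Site 3 1), (0 : Fin 3)) * (polyakovSite s U ((0 : Site 3 1), (1 : Fin 3)))⁻¹)).trace.re) ^ 2 - ((su2Rep (polyakovSite s U ((0 : Site 3 1), (0 : Fin 3)) * polyakovSite s U ((0 : Site 3 1), (1 : Fin 3)))).trace.re) ^ 2) / 16) U * Ω U * ∑ x : Site 3 L, deriv (fun t : ℝ => Ω (Function.update U (x, (0 : Fin 3)) (U (x, (0 : Fin 3)) * expPauli (t • ((EuclideanSpace.equiv (Fin 3) ℝ).symm fun a => (-(Complex.I / 2) * (pauli a * (((fun m : Site 3 L → Matrix (Fin 2) (Fin 2) ℂ => fun s : Site 3 L =>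
          (1 / 5 : ℂ) • (m s + ∑ i ∈ ({1, 2} : Finset (Fin 3)),
            (su2Rep (U (s, i)) * m (s.shift i) * su2Rep (U (s, i))⁻¹ +
              su2Rep (U (s - Pi.single i 1, i))⁻¹ * m (s - Pi.single i 1) * su2Rep (U (s - Pi.single i 1, i))))))^[L ^ 2 * (⌈Real.log β⌉₊ + 1)] (fun s : Site 3 L =>
          ((su2Rep (polyakovSite s U ((0 : Site 3 1), (1 : Fin 3)))).trace.re : ℂ) •
            ((1 / 2 : ℂ) • (su2Rep (polyakovSite s U ((0 : Site 3 1), (1 : Fin 3))) - su2Rep (polyakovSite s U ((0 : Site 3 1), (1 : Fin 3)))⁻¹))) ((x).shift 0))).trace).re))))) 0) =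
        fun U => ∑ x : Site 3 L, (fun U : GaugeConfig 3 L SU2 => ∑ s : Site 3 L, (((su2Rep (polyakovSite s U ((0 : Site 3 1), (0 : Fin 3)) * (polyakovSite s U ((0 : Site 3 1), (1 : Fin 3)))⁻¹)).trace.re) ^ 2 - ((su2Rep (polyakovSite s U ((0 : Site 3 1), (0 : Fin 3)) * polyakovSite s U ((0 : Site 3 1), (1 : Fin 3)))).trace.re) ^ 2) / 16) U * Ω U * deriv (fun t : ℝ => Ω (Function.update U (x, (0 : Fin 3)) (U (x, (0 : Fin 3)) * expPauli (t • ((EuclideanSpace.equiv (Fin 3) ℝ).symm fun a => (-(Complex.I / 2) * (pauli a * (((fun m : Site 3 L → Matrix (Fin 2) (Fin 2) ℂ => fun s : Site 3 L =>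
          (1 / 5 : ℂ) • (m s + ∑ i ∈ ({1, 2} : Finset (Fin 3)),
            (su2Rep (U (s, i)) * m (s.shift i) * su2Rep (U (s, i))⁻¹ +
              su2Rep (U (s - Pi.single i 1, i))⁻¹ * m (s - Pi.single i 1) * su2Rep (U (s - Pi.single i 1, i))))))^[L ^ 2 * (⌈Real.log β⌉₊ + 1)] (fun s : Site 3 L =>
          ((su2Rep (polyakovSite s U ((0 : Site 3 1), (1 : Fin 3)))).trace.re : ℂ) •
            ((1 / 2 : ℂ) • (su2Rep (polyakovSite s U ((0 : Site 3 1), (1 : Fin 3))) - su2Rep (polyakovSite s U ((0 : Site 3 1), (1 : Fin 3)))⁻¹))) ((x).shift 0))).trace).re))))) 0 from funext fun U => Finset.mul_sum _ _ _,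
      integral_finsetSum _ fun x _ => hi2 x, Finset.mul_sum]
    exact Finset.sum_congr rfl fun x _ => hint x
  have hCS := l2_sq_le_of_bdd' hgm hXΩc.measurable ⟨_, hgb⟩ ⟨CX, hCX⟩
  rw [hkey]
  nlinarith [hCS]

end Summit.QuantumFields.YangMills.Theorems.CovariantCurrentDoor

end
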